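import Literature.RingTheory.MvPolynomial.CubicFormPlaneChains
import Literature.FieldTheory.QuasiAlgClosed.TsenSystems
import HarnessLib

/-!
# Chains of isotropic subspaces of a cubic form over `C_r` fields (Tsen–Lang ranges)

`Literature/RingTheory/MvPolynomial/CubicFormPlaneChains.lean` finds common isotropic extensions of
isotropic subspaces of a cubic form over an ALGEBRAICALLY CLOSED field, by the projective dimension
theorem (fewer forms than variables). Over the function field `K` of a curve (or a surface) over an
algebraically closed field the same systems of forms are solved by **Tsen–Lang**: `K` has Pfister's
systems property `C₁` (resp. `C₂`), `Literature.FieldTheory.QuasiAlgClosed.IsCrSystem`,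
`isCrSystem_one_of_trdeg_eq_one` — a system of forms of positive degrees `d_j` in `n` variables with
`Σ d_j^r < n` has a nontrivial common zero. This file re-runs the constructions with that solver and
the corresponding DEGREE counts (`Σ_f (3 - |f|)^r` over the same sets of monomials `f`):

* `sum_pow_le_filter_of_degree_lt_three`, `sum_pow_le_filter_of_degree_lt_three_or` — the degree
  sums of the actual conditions are bounded by those over the model sets of monomials;
* `exists_finCons_eval_eq_zero_of_isCrSystem` — the one-subspace greedy step;
* `exists_common_zero_two_subframes_escaping_of_isCrSystem` — the two-sub-frame step;
* `exists_isotropic_succ_of_isCrSystem_one`, `exists_isotropic_finrank_three_ge_of_isCrSystem_one`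
  (`C₁`, `N ≥ 12`: degree counts `3`, `6 + 1`, `10 + 2`), and
  `exists_common_isotropic_extension_inf_of_isCrSystem` (general `r`, count hypothesis; the `C₁`
  counts are `9 + 0`, `14 + 1`, `20 + 2` for `d = 0, 1, 2`: `sum_filter_fin_two_or_pow_one`, …).

* `exists_line_between_of_finrank_inf_eq_one`, `reflTransGen_coplanar_of_one_le_finrank_inf`,
  `reflTransGen_coplanar_of_isCrSystem_one` — **any two isotropic lines are chain-connected through
  isotropic `3`-spaces over a `C₁` field, `N ≥ 15`**: geometrically, any two `K`-lines of a cubic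
  hypersurface `X ⊆ ℙᴺ` of dimension `N - 1 ≥ 14` over the function field `K` of a curve are joined
  by a chain of `K`-lines of `X_K` in which consecutive lines span a `K`-plane of `X_K` — the input
  of the product-trick argument for `2`-cycles (families of lines over a curve ↦ planes).

Everything is proved; no definitions. [folklore]
-/

noncomputable section

open MvPolynomial Literature.FieldTheory.QuasiAlgClosed

namespace Literature.RingTheory.MvPolynomial

universe u

variable {k : Type u} [Field k] {N : ℕ}

/-! ### Degree sums of the conditions -/

section Counting

variable {u m : ℕ}

/-- The degree sum `Σ (3 - |α|)^r` of the conditions of the one-subspace step is bounded by the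
model sum over the maps `f : Fin u → Fin 3` with `Σ f ≤ 2`. [folklore] -/
theorem sum_pow_le_filter_of_degree_lt_three (S : Finset (Fin u →₀ ℕ))
    (hS : ∀ α ∈ S, α.degree < 3) (r : ℕ) :
    ∑ α ∈ S, (3 - α.degree) ^ r ≤
      (Finset.univ.filter (fun f : Fin u → Fin 3 => ∑ j, (f j : ℕ) ≤ 2)).sum
        (fun f => (3 - ∑ j, (f j : ℕ)) ^ r) := by
  classical
  have hle : ∀ α ∈ S, ∀ j, α j ≤ 2 := fun α hα j =>
    Nat.le_of_lt_succ (lt_of_le_of_lt (Finsupp.le_degree j α) (hS α hα))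
  set φ : (Fin u →₀ ℕ) → (Fin u → Fin 3) := fun α j => (⟨min (α j) 2, by omega⟩ : Fin 3) with hφ
  have hdegφ : ∀ α ∈ S, ∑ j, ((φ α j : Fin 3) : ℕ) = α.degree := fun α hα => by
    rw [Finsupp.degree_eq_sum]
    exact Finset.sum_congr rfl fun j _ => min_eq_left (hle α hα j)
  have hinj : Set.InjOn φ ↑S := fun α hα β hβ h => by
    ext j
    have hj := congr_fun h j
    simp only [hφ, Fin.mk.injEq] at hj
    rwa [min_eq_left (hle α hα j), min_eq_left (hle β hβ j)] at hj
  have himage : S.image φ ⊆ Finset.univ.filter (fun f : Fin u → Fin 3 => ∑ j, (f j : ℕ) ≤ 2) := by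
    intro f hf
    obtain ⟨α, hα, rfl⟩ := Finset.mem_image.1 hf
    rw [Finset.mem_filter, hdegφ α hα]
    exact ⟨Finset.mem_univ _, Nat.le_of_lt_succ (hS α hα)⟩
  calc ∑ α ∈ S, (3 - α.degree) ^ r
      = ∑ α ∈ S, (3 - ∑ j, ((φ α j : Fin 3) : ℕ)) ^ r :=
        Finset.sum_congr rfl fun α hα => by rw [hdegφ α hα]
    _ = ∑ f ∈ S.image φ, (3 - ∑ j, (f j : ℕ)) ^ r := by rw [Finset.sum_image hinj]
    _ ≤ _ := Finset.sum_le_sum_of_subset himage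

/-- The degree sum of the conditions of the two-sub-frame step is bounded by the model sum over
the maps `f : Fin m → Fin 3` with `Σ f ≤ 2` and `f i₁ = 0 ∨ f i₂ = 0`. [folklore] -/
theorem sum_pow_le_filter_of_degree_lt_three_or (i₁ i₂ : Fin m) (S : Finset (Fin m →₀ ℕ))
    (hS : ∀ α ∈ S, α.degree < 3 ∧ (α i₁ = 0 ∨ α i₂ = 0)) (r : ℕ) :
    ∑ α ∈ S, (3 - α.degree) ^ r ≤
      (Finset.univ.filter (fun f : Fin m → Fin 3 =>
        ∑ j, (f j : ℕ) ≤ 2 ∧ (f i₁ = 0 ∨ f i₂ = 0))).sum (fun f => (3 - ∑ j, (f j : ℕ)) ^ r) := by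
  classical
  have hle : ∀ α ∈ S, ∀ j, α j ≤ 2 := fun α hα j =>
    Nat.le_of_lt_succ (lt_of_le_of_lt (Finsupp.le_degree j α) (hS α hα).1)
  set φ : (Fin m →₀ ℕ) → (Fin m → Fin 3) := fun α j => (⟨min (α j) 2, by omega⟩ : Fin 3) with hφ
  have hdegφ : ∀ α ∈ S, ∑ j, ((φ α j : Fin 3) : ℕ) = α.degree := fun α hα => by
    rw [Finsupp.degree_eq_sum]
    exact Finset.sum_congr rfl fun j _ => min_eq_left (hle α hα j)
  have hinj : Set.InjOn φ ↑S := fun α hα β hβ h => by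
    ext j
    have hj := congr_fun h j
    simp only [hφ, Fin.mk.injEq] at hj
    rwa [min_eq_left (hle α hα j), min_eq_left (hle β hβ j)] at hj
  have himage : S.image φ ⊆ Finset.univ.filter (fun f : Fin m → Fin 3 =>
      ∑ j, (f j : ℕ) ≤ 2 ∧ (f i₁ = 0 ∨ f i₂ = 0)) := by
    intro f hf
    obtain ⟨α, hα, rfl⟩ := Finset.mem_image.1 hf
    rw [Finset.mem_filter, hdegφ α hα]
    refine ⟨Finset.mem_univ _, Nat.le_of_lt_succ (hS α hα).1, ?_⟩
    rcases (hS α hα).2 with h | h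
    · left; exact Fin.ext (by simp [hφ, h])
    · right; exact Fin.ext (by simp [hφ, h])
  calc ∑ α ∈ S, (3 - α.degree) ^ r
      = ∑ α ∈ S, (3 - ∑ j, ((φ α j : Fin 3) : ℕ)) ^ r :=
        Finset.sum_congr rfl fun α hα => by rw [hdegφ α hα]
    _ = ∑ f ∈ S.image φ, (3 - ∑ j, (f j : ℕ)) ^ r := by rw [Finset.sum_image hinj]
    _ ≤ _ := Finset.sum_le_sum_of_subset himage

/-- `C₁` count for the one-subspace step, `u = 0`: the empty monomial, degree `3`. [folklore] -/
theorem sum_filter_fin_zero_pow_one :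
    (Finset.univ.filter (fun f : Fin 0 → Fin 3 => ∑ j, (f j : ℕ) ≤ 2)).sum
      (fun f => (3 - ∑ j, (f j : ℕ)) ^ 1) = 3 := by
  decide

/-- `C₁` count for the one-subspace step, `u = 1`: degrees `3, 2, 1`. [folklore] -/
theorem sum_filter_fin_one_pow_one :
    (Finset.univ.filter (fun f : Fin 1 → Fin 3 => ∑ j, (f j : ℕ) ≤ 2)).sum
      (fun f => (3 - ∑ j, (f j : ℕ)) ^ 1) = 6 := by
  decide

/-- `C₁` count for the one-subspace step, `u = 2`: degrees `3, 2, 2, 1, 1, 1`. [folklore] -/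
theorem sum_filter_fin_two_pow_one :
    (Finset.univ.filter (fun f : Fin 2 → Fin 3 => ∑ j, (f j : ℕ) ≤ 2)).sum
      (fun f => (3 - ∑ j, (f j : ℕ)) ^ 1) = 10 := by
  decide

/-- `C₁` count for two lines through the origin (`d = 0`): `9`. [folklore] -/
theorem sum_filter_fin_two_or_pow_one :
    (Finset.univ.filter (fun f : Fin 2 → Fin 3 =>
      ∑ j, (f j : ℕ) ≤ 2 ∧ (f 1 = 0 ∨ f 0 = 0))).sum (fun f => (3 - ∑ j, (f j : ℕ)) ^ 1) = 9 := by
  decide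

/-- `C₁` count for two `2`-spaces through a common line (`d = 1`): `14`. [folklore] -/
theorem sum_filter_fin_three_or_pow_one :
    (Finset.univ.filter (fun f : Fin 3 → Fin 3 =>
      ∑ j, (f j : ℕ) ≤ 2 ∧ (f 1 = 0 ∨ f 0 = 0))).sum (fun f => (3 - ∑ j, (f j : ℕ)) ^ 1) = 14 := by
  decide

/-- `C₁` count for two `3`-spaces through a common `2`-space (`d = 2`): `20`. [folklore] -/
theorem sum_filter_fin_four_or_pow_one :
    (Finset.univ.filter (fun f : Fin 4 → Fin 3 =>
      ∑ j, (f j : ℕ) ≤ 2 ∧ (f 1 = 0 ∨ f 0 = 0))).sum (fun f => (3 - ∑ j, (f j : ℕ)) ^ 1) = 20 := by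
  decide

end Counting

/-! ### The greedy steps over a `C_r` field -/

section Steps

variable {u m : ℕ}

/-- **The one-subspace greedy step over a `C_r` field** (cf. `exists_finCons_eval_eq_zero`): a cubic
form vanishing on the span of `u` independent vectors vanishes on a `(u+1)`-dimensional subspace
containing it, as soon as `Σ_f (3 - |f|)^r + u < N + 1` (sum over the monomials `f` of degree `≤ 2` in
`u` variables). [folklore] -/
theorem exists_finCons_eval_eq_zero_of_isCrSystem {r : ℕ} (hK : IsCrSystem r k)
    {F : MvPolynomial (Fin (N + 1)) k}
    (hF : F.IsHomogeneous 3) {w : Fin u → Fin (N + 1) → k} (hw : LinearIndependent k w)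
    (hvan : ∀ c : Fin u → k, eval (fun m => ∑ j, c j * w j m) F = 0)
    (hN : (Finset.univ.filter (fun f : Fin u → Fin 3 => ∑ j, (f j : ℕ) ≤ 2)).sum
      (fun f => (3 - ∑ j, (f j : ℕ)) ^ r) + u < N + 1) :
    ∃ y : Fin (N + 1) → k, LinearIndependent k (Fin.cons y w : Fin (u + 1) → Fin (N + 1) → k) ∧
      ∀ c : Fin (u + 1) → k,
        eval (fun m => ∑ j, c j * (Fin.cons y w : Fin (u + 1) → Fin (N + 1) → k) j m) F = 0 := by
  classical
  -- the substituted form `P = F(Σ_j s_j w_j + y)` and its bihomogeneity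
  set P : MvPolynomial (Fin u) (MvPolynomial (Fin (N + 1)) k) :=
    aeval (fun m : Fin (N + 1) =>
      (∑ j : Fin u, C (C (w j m)) * X j) + C (X m) :
        Fin (N + 1) → MvPolynomial (Fin u) (MvPolynomial (Fin (N + 1)) k)) F with hP_def
  have hP : ∀ α, (coeff α P).IsHomogeneous (3 - α.degree) ∧ (3 < α.degree → coeff α P = 0) := by
    refine isBihom_aeval hF _ fun m => ?_
    refine isBihom_add (isBihom_sum _ _ fun j _ => ?_)
      (isBihom_C_of_isHomogeneous_one (isHomogeneous_X k m))
    simpa using isBihom_mul (isBihom_C_C (σ := Fin u) (τ := Fin (N + 1)) (w j m))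
      (isBihom_X (k := k) (τ := Fin (N + 1)) j)
  -- a retraction `ψ` of `c ↦ Σ_j c_j w_j`
  have hinj : Function.Injective (Fintype.linearCombination k w) :=
    linearIndependent_iff_injective_fintypeLinearCombination.mp hw
  obtain ⟨ψ, hψ⟩ := LinearMap.exists_leftInverse_of_injective _ (LinearMap.ker_eq_bot.mpr hinj)
  -- the system of conditions: coefficients of `s`-degree `< 3` and the escape forms
  set S : Finset (Fin u →₀ ℕ) := P.support.filter (fun α => α.degree < 3) with hS_def
  have hS3 : ∀ α ∈ S, α.degree < 3 := fun α hα => (Finset.mem_filter.mp hα).2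
  let g : ↥S ⊕ Fin u → MvPolynomial (Fin (N + 1)) k :=
    Sum.elim (fun α => coeff α.1 P) (fun j => ∑ m : Fin (N + 1), C (ψ (Pi.single m 1) j) * X m)
  let deg : ↥S ⊕ Fin u → ℕ := Sum.elim (fun α => 3 - α.1.degree) (fun _ => 1)
  have hg : ∀ i, (g i).IsHomogeneous (deg i) := by
    rintro (α | j)
    · exact (hP α.1).1
    · exact isHomogeneous_escapeForm ψ j
  have hdeg : ∀ i, 0 < deg i := by
    rintro (α | j)
    · have := hS3 α.1 α.2
      change 0 < 3 - α.1.degree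
      omega
    · exact Nat.one_pos
  have hsum : ∑ i, deg i ^ r < Fintype.card (Fin (N + 1)) := by
    rw [Fintype.card_fin, Fintype.sum_sum_type]
    have h1 : ∑ a : ↥S, deg (Sum.inl a) ^ r = ∑ α ∈ S, (3 - α.degree) ^ r :=
      Finset.sum_coe_sort S (fun α => (3 - α.degree) ^ r)
    have h2 : ∑ a : Fin u, deg (Sum.inr a) ^ r = u := by simp [deg]
    rw [h1, h2]
    exact lt_of_le_of_lt (Nat.add_le_add_right (sum_pow_le_filter_of_degree_lt_three S hS3 r) u) hN
  obtain ⟨y, hy0, hy⟩ := hK.exists_common_zero g deg hdeg hg hsum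
  have hyS : ∀ α ∈ P.support, α.degree < 3 → eval y (coeff α P) = 0 := fun α hα hd =>
    hy (Sum.inl ⟨α, Finset.mem_filter.mpr ⟨hα, hd⟩⟩)
  have hyψ : ψ y = 0 := by
    ext j
    rw [← eval_escapeForm ψ j y]
    exact hy (Sum.inr j)
  have hy_span : y ∉ Submodule.span k (Set.range w) := by
    intro hmem
    rw [← Fintype.range_linearCombination] at hmem
    obtain ⟨c, rfl⟩ := hmem
    have hc : ψ (Fintype.linearCombination k w c) = c := by
      have := LinearMap.congr_fun hψ c
      simpa using this
    have hc0 : c = 0 := hc.symm.trans hyψ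
    exact hy0 (by rw [hc0, map_zero])
  refine ⟨y, hw.finCons hy_span, fun c => ?_⟩
  -- `F` vanishes on `span(w) + k y`
  have key := eval_eval_smul_eq_of_isBihom hP hyS (fun j => c j.succ) (c 0)
  rw [hP_def, eval_eval_aeval_lin, eval_eval_aeval_lin] at key
  have h0 : eval (fun m => (∑ j, c j.succ * w j m) + (0 : Fin (N + 1) → k) m) F = 0 := by
    simpa using hvan (fun j => c j.succ)
  rw [h0] at key
  have hfun : (fun m => ∑ j, c j * (Fin.cons y w : Fin (u + 1) → Fin (N + 1) → k) j m) =
      fun m => (∑ j, c j.succ * w j m) + (c 0 • y) m := by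
    ext m
    rw [Fin.sum_univ_succ]
    simp only [Fin.cons_zero, Fin.cons_succ, Pi.smul_apply, smul_eq_mul]
    ring
  rw [hfun]
  exact key


/-- **The two-sub-frame greedy step over a `C_r` field, escaping part of the frame** (cf.
`exists_common_zero_two_subframes_escaping`), with the degree count
`Σ_f (3 - |f|)^r + #S < N + 1`. [folklore] -/
theorem exists_common_zero_two_subframes_escaping_of_isCrSystem {r : ℕ} (hK : IsCrSystem r k)
    {F : MvPolynomial (Fin (N + 1)) k}
    (hF : F.IsHomogeneous 3) {e : Fin m → Fin (N + 1) → k} (he : LinearIndependent k e)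
    (i₁ i₂ : Fin m) (S : Finset (Fin m))
    (h₁ : ∀ c : Fin m → k, c i₂ = 0 → eval (fun x => ∑ j, c j * e j x) F = 0)
    (h₂ : ∀ c : Fin m → k, c i₁ = 0 → eval (fun x => ∑ j, c j * e j x) F = 0)
    (hN : (Finset.univ.filter (fun f : Fin m → Fin 3 =>
      ∑ j, (f j : ℕ) ≤ 2 ∧ (f i₁ = 0 ∨ f i₂ = 0))).sum (fun f => (3 - ∑ j, (f j : ℕ)) ^ r) +
        S.card < N + 1) :
    ∃ y : Fin (N + 1) → k, y ∉ Submodule.span k (e '' ↑S) ∧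
      (∀ (c : Fin m → k) (t : k), c i₂ = 0 →
        eval (fun x => (∑ j, c j * e j x) + t * y x) F = 0) ∧
      (∀ (c : Fin m → k) (t : k), c i₁ = 0 →
        eval (fun x => (∑ j, c j * e j x) + t * y x) F = 0) := by
  classical
  -- the substituted form `P = F(Σ_j s_j e_j + y)` and its bihomogeneity
  set P : MvPolynomial (Fin m) (MvPolynomial (Fin (N + 1)) k) :=
    aeval (fun x : Fin (N + 1) =>
      (∑ j : Fin m, C (C (e j x)) * X j) + C (X x) :
        Fin (N + 1) → MvPolynomial (Fin m) (MvPolynomial (Fin (N + 1)) k)) F with hP_def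
  have hP : ∀ α, (coeff α P).IsHomogeneous (3 - α.degree) ∧ (3 < α.degree → coeff α P = 0) := by
    refine isBihom_aeval hF _ fun x => ?_
    refine isBihom_add (isBihom_sum _ _ fun j _ => ?_)
      (isBihom_C_of_isHomogeneous_one (isHomogeneous_X k x))
    simpa using isBihom_mul (isBihom_C_C (σ := Fin m) (τ := Fin (N + 1)) (e j x))
      (isBihom_X (k := k) (τ := Fin (N + 1)) j)
  -- the sub-frame `u = e|_S` (reindexed by `Fin #S`) and a retraction `ψ` of `c ↦ Σ_a c_a u_a`
  set u : Fin S.card → Fin (N + 1) → k := fun a => e (S.equivFin.symm a) with hu_def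
  have hu : LinearIndependent k u :=
    he.comp _ (Subtype.val_injective.comp S.equivFin.symm.injective)
  have hurange : Set.range u = e '' ↑S := by
    ext v
    constructor
    · rintro ⟨a, rfl⟩
      exact ⟨_, (S.equivFin.symm a).2, rfl⟩
    · rintro ⟨j, hj, rfl⟩
      exact ⟨S.equivFin ⟨j, hj⟩, by simp [hu_def]⟩
  have hinj : Function.Injective (Fintype.linearCombination k u) :=
    linearIndependent_iff_injective_fintypeLinearCombination.mp hu
  obtain ⟨ψ, hψ⟩ := LinearMap.exists_leftInverse_of_injective _ (LinearMap.ker_eq_bot.mpr hinj)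
  -- the system of conditions: coefficients, and escape forms for the sub-frame only
  set T : Finset (Fin m →₀ ℕ) :=
    P.support.filter (fun α => α.degree < 3 ∧ (α i₁ = 0 ∨ α i₂ = 0)) with hT_def
  have hTd : ∀ α ∈ T, α.degree < 3 ∧ (α i₁ = 0 ∨ α i₂ = 0) := fun α hα =>
    (Finset.mem_filter.mp hα).2
  let g : ↥T ⊕ Fin S.card → MvPolynomial (Fin (N + 1)) k :=
    Sum.elim (fun α => coeff α.1 P) (fun a => ∑ x : Fin (N + 1), C (ψ (Pi.single x 1) a) * X x)
  let deg : ↥T ⊕ Fin S.card → ℕ := Sum.elim (fun α => 3 - α.1.degree) (fun _ => 1)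
  have hg : ∀ i, (g i).IsHomogeneous (deg i) := by
    rintro (α | a)
    · exact (hP α.1).1
    · exact isHomogeneous_escapeForm ψ a
  have hdeg : ∀ i, 0 < deg i := by
    rintro (α | a)
    · have := (hTd α.1 α.2).1
      change 0 < 3 - α.1.degree
      omega
    · exact Nat.one_pos
  have hsum : ∑ i, deg i ^ r < Fintype.card (Fin (N + 1)) := by
    rw [Fintype.card_fin, Fintype.sum_sum_type]
    have h1 : ∑ a : ↥T, deg (Sum.inl a) ^ r = ∑ α ∈ T, (3 - α.degree) ^ r :=
      Finset.sum_coe_sort T (fun α => (3 - α.degree) ^ r)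
    have h2 : ∑ a : Fin S.card, deg (Sum.inr a) ^ r = S.card := by simp [deg]
    rw [h1, h2]
    exact lt_of_le_of_lt
      (Nat.add_le_add_right (sum_pow_le_filter_of_degree_lt_three_or i₁ i₂ T hTd r) S.card) hN
  obtain ⟨y, hy0, hy⟩ := hK.exists_common_zero g deg hdeg hg hsum
  have hyT : ∀ α ∈ P.support, α.degree < 3 → (α i₁ = 0 ∨ α i₂ = 0) →
      eval y (coeff α P) = 0 :=
    fun α hα hlt hor => hy (Sum.inl ⟨α, Finset.mem_filter.mpr ⟨hα, hlt, hor⟩⟩)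
  have hyψ : ψ y = 0 := by
    ext a
    rw [← eval_escapeForm ψ a y]
    exact hy (Sum.inr a)
  have hy_span : y ∉ Submodule.span k (e '' ↑S) := by
    rw [← hurange]
    intro hmem
    rw [← Fintype.range_linearCombination] at hmem
    obtain ⟨c, rfl⟩ := hmem
    have hc : ψ (Fintype.linearCombination k u c) = c := by
      have := LinearMap.congr_fun hψ c
      simpa using this
    have hc0 : c = 0 := hc.symm.trans hyψ
    exact hy0 (by rw [hc0, map_zero])
  -- verification, for a substitution killing `s_{i₂}` (resp. `s_{i₁}`)
  have key : ∀ (c : Fin m → k) (t : k), (∀ α ∈ P.support, α.degree < 3 →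
      (∀ j, c j = 0 → α j = 0) → eval y (coeff α P) = 0) →
      eval (fun x => ∑ j, c j * e j x) F = 0 →
        eval (fun x => (∑ j, c j * e j x) + t * y x) F = 0 := by
    intro c t hc h0
    have hk := eval_eval_smul_eq_of_isBihom_of_vanishing hP c hc t
    rw [hP_def] at hk
    rw [eval_eval_aeval_lin, eval_eval_aeval_lin] at hk
    have h0' : eval (fun x => (∑ j, c j * e j x) + (0 : Fin (N + 1) → k) x) F = 0 := by
      simpa using h0
    rw [h0'] at hk
    have hfun : (fun x => (∑ j, c j * e j x) + t * y x) =
        fun x => (∑ j, c j * e j x) + (t • y) x := by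
      ext x
      simp only [Pi.smul_apply, smul_eq_mul]
    rw [hfun]
    exact hk
  refine ⟨y, hy_span, fun c t hc => key c t (fun α hα hlt hαc => ?_) (h₁ c hc),
    fun c t hc => key c t (fun α hα hlt hαc => ?_) (h₂ c hc)⟩
  · exact hyT α hα hlt (Or.inr (hαc i₂ hc))
  · exact hyT α hα hlt (Or.inl (hαc i₁ hc))


end Steps


/-! ### Linear algebra of `S + ky` (file-local copies) -/

section SupSpan

/-- `dim (S + ky) = dim S + 1` for `y ∉ S` — this is Mathlib's `Submodule.finrank_sup_span_singleton`
(`Mathlib/LinearAlgebra/FiniteDimensional/Lemmas.lean`); kept as a deprecated alias (librarian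
dedup-01464). [folklore] -/
@[deprecated Submodule.finrank_sup_span_singleton (since := "2026-08-16")]
alias finrank_sup_span_singleton_of_notMem' := Submodule.finrank_sup_span_singleton

/-- A property of all `w + t • y`, `w ∈ S`, holds on `S + ky`. [folklore] -/
theorem forall_mem_sup_span_singleton' {S : Submodule k (Fin (N + 1) → k)}
    {y : Fin (N + 1) → k} {P : (Fin (N + 1) → k) → Prop}
    (h : ∀ w ∈ S, ∀ t : k, P (w + t • y)) : ∀ v ∈ S ⊔ Submodule.span k {y}, P v := by
  intro v hv
  obtain ⟨w, hw, u, hu, rfl⟩ := Submodule.mem_sup.1 hv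
  obtain ⟨t, rfl⟩ := Submodule.mem_span_singleton.1 hu
  exact h w hw t

/-- `dim (ky) ≤ 1`. [folklore] -/
theorem finrank_span_singleton_le' (y : Fin (N + 1) → k) :
    Module.finrank k ↥(Submodule.span k {y}) ≤ 1 := by
  by_cases hy : y = 0
  · rw [hy, Submodule.span_zero_singleton, finrank_bot]
    exact Nat.zero_le _
  · rw [finrank_span_singleton hy]

end SupSpan

/-! ### Isotropic subspaces over `C_r` fields -/

section Isotropic

variable {F : MvPolynomial (Fin (N + 1)) k}

/-- **One greedy step over a `C₁` field, subspace form**: an isotropic subspace of dimension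
`d ≤ 2` of a cubic form in `N + 1 ≥ 13` variables over a field with the systems property `C₁`
(e.g. the function field of a curve over an algebraically closed field, Tsen–Lang) lies in an
isotropic subspace of dimension `d + 1` (degree counts `3`, `3 + 2 + 1 + 1`, `10 + 2 < N + 1`).
[folklore] -/
theorem exists_isotropic_succ_of_isCrSystem_one (hK : IsCrSystem 1 k) (hN : 12 ≤ N)
    (hF : F.IsHomogeneous 3)
    {W : Submodule k (Fin (N + 1) → k)} {d : ℕ} (hd : d ≤ 2) (hW : Module.finrank k W = d)
    (hiso : ∀ v ∈ W, eval v F = 0) :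
    ∃ W' : Submodule k (Fin (N + 1) → k), W ≤ W' ∧ Module.finrank k W' = d + 1 ∧
      ∀ v ∈ W', eval v F = 0 := by
  have hcount : (Finset.univ.filter (fun f : Fin d → Fin 3 => ∑ j, (f j : ℕ) ≤ 2)).sum
      (fun f => (3 - ∑ j, (f j : ℕ)) ^ 1) + d < N + 1 := by
    interval_cases d
    · rw [sum_filter_fin_zero_pow_one]; omega
    · rw [sum_filter_fin_one_pow_one]; omega
    · rw [sum_filter_fin_two_pow_one]; omega
  obtain ⟨w, hw, hspan⟩ := exists_frame_of_finrank_eq hW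
  have hvan : ∀ c : Fin d → k, eval (fun m => ∑ j, c j * w j m) F = 0 := by
    intro c
    rw [sum_mul_apply_eq_sum_smul]
    refine hiso _ (Submodule.sum_mem _ fun j _ => Submodule.smul_mem _ _ ?_)
    rw [← hspan]
    exact Submodule.subset_span ⟨j, rfl⟩
  obtain ⟨y, hy, hvy⟩ := exists_finCons_eval_eq_zero_of_isCrSystem hK hF hw hvan hcount
  refine ⟨Submodule.span k (Set.range (Fin.cons y w : Fin (d + 1) → Fin (N + 1) → k)), ?_, ?_,
    forall_mem_span_range_eval_eq_zero hvy⟩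
  · rw [← hspan]
    refine Submodule.span_mono ?_
    rw [Fin.range_cons]
    exact Set.subset_insert _ _
  · rw [finrank_span_eq_card hy, Fintype.card_fin]

/-- **Every isotropic subspace of dimension `≤ 2` lies in an isotropic subspace of dimension `3`,
over a `C₁` field** (cubic form in `N + 1 ≥ 13` variables): e.g. every `K`-line of a cubic
hypersurface of dimension `≥ 11` over the function field `K` of a curve lies in a `K`-plane of it.
[folklore] -/
theorem exists_isotropic_finrank_three_ge_of_isCrSystem_one (hK : IsCrSystem 1 k)
    (hN : 12 ≤ N) (hF : F.IsHomogeneous 3)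
    {W : Submodule k (Fin (N + 1) → k)} (hd : Module.finrank k W ≤ 2)
    (hiso : ∀ v ∈ W, eval v F = 0) :
    ∃ Q : Submodule k (Fin (N + 1) → k), W ≤ Q ∧ Module.finrank k Q = 3 ∧ ∀ v ∈ Q, eval v F = 0 := by
  obtain ⟨d, hW⟩ : ∃ d, Module.finrank k W = d := ⟨_, rfl⟩
  rw [hW] at hd
  interval_cases d
  · obtain ⟨W₁, h01, h1, hiso₁⟩ := exists_isotropic_succ_of_isCrSystem_one hK hN hF (d := 0) (by omega) hW hiso
    obtain ⟨W₂, h12, h2, hiso₂⟩ := exists_isotropic_succ_of_isCrSystem_one hK hN hF (d := 1) (by omega) h1 hiso₁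
    obtain ⟨W₃, h23, h3, hiso₃⟩ := exists_isotropic_succ_of_isCrSystem_one hK hN hF (d := 2) (by omega) h2 hiso₂
    exact ⟨W₃, h01.trans (h12.trans h23), h3, hiso₃⟩
  · obtain ⟨W₂, h12, h2, hiso₂⟩ := exists_isotropic_succ_of_isCrSystem_one hK hN hF (d := 1) (by omega) hW hiso
    obtain ⟨W₃, h23, h3, hiso₃⟩ := exists_isotropic_succ_of_isCrSystem_one hK hN hF (d := 2) (by omega) h2 hiso₂
    exact ⟨W₃, h12.trans h23, h3, hiso₃⟩
  · obtain ⟨W₃, h23, h3, hiso₃⟩ := exists_isotropic_succ_of_isCrSystem_one hK hN hF (d := 2) (by omega) hW hiso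
    exact ⟨W₃, h23, h3, hiso₃⟩


/-- An isotropic subspace of dimension `≤ 3` lies in an isotropic subspace of dimension `3` (`C₁`
field, `N ≥ 12`). [folklore] -/
theorem exists_isotropic_finrank_three_ge_of_le_three (hK : IsCrSystem 1 k) (hN : 12 ≤ N)
    (hF : F.IsHomogeneous 3) {W : Submodule k (Fin (N + 1) → k)} (hd : Module.finrank k W ≤ 3)
    (hiso : ∀ v ∈ W, eval v F = 0) :
    ∃ Q : Submodule k (Fin (N + 1) → k), W ≤ Q ∧ Module.finrank k Q = 3 ∧ ∀ v ∈ Q, eval v F = 0 := by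
  by_cases h3 : Module.finrank k W = 3
  · exact ⟨W, le_rfl, h3, hiso⟩
  · exact exists_isotropic_finrank_three_ge_of_isCrSystem_one hK hN hF (by omega) hiso

/-- **Common isotropic extension of two isotropic subspaces meeting in codimension one, over a
`C_r` field** (cf. `exists_common_isotropic_extension`). Let `F` be a cubic form on `kᴺ⁺¹`, `k` with
Pfister's systems property `C_r`, and `W₁, W₂` isotropic subspaces of dimension
`d + 1` with `dim (W₁ ∩ W₂) = d`. If `Σ_f (3 - |f|)^r + (d + 2) < N + 1` (sum over
`f : Fin (d+2) → Fin 3`, `Σ f ≤ 2`, `f 1 = 0 ∨ f 0 = 0`; for `r = 1`: `9 + 2`, `14 + 3`, `20 + 4`), there is a vector `y ∉ W₁ + W₂`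
such that `W₁ + ky` and `W₂ + ky` are isotropic (`exists_common_zero_two_subframes` for the frame
`(v₂, v₁, u)`, `u` a frame of `W₁ ∩ W₂`, `W_a = span(v_a, u)`). [folklore] -/
theorem exists_common_isotropic_extension_of_isCrSystem {r : ℕ} (hK : IsCrSystem r k)
    (hF : F.IsHomogeneous 3) {d : ℕ}
    {W₁ W₂ : Submodule k (Fin (N + 1) → k)} (h₁ : Module.finrank k W₁ = d + 1)
    (h₂ : Module.finrank k W₂ = d + 1) (h₁₂ : Module.finrank k ↥(W₁ ⊓ W₂) = d)
    (hiso₁ : ∀ v ∈ W₁, eval v F = 0) (hiso₂ : ∀ v ∈ W₂, eval v F = 0)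
    (hN : (Finset.univ.filter (fun f : Fin (d + 2) → Fin 3 =>
      ∑ j, (f j : ℕ) ≤ 2 ∧ (f 1 = 0 ∨ f 0 = 0))).sum (fun f => (3 - ∑ j, (f j : ℕ)) ^ r) +
        (d + 2) < N + 1) :
    ∃ y : Fin (N + 1) → k, y ∉ W₁ ⊔ W₂ ∧ (∀ w ∈ W₁, ∀ t : k, eval (w + t • y) F = 0) ∧
      ∀ w ∈ W₂, ∀ t : k, eval (w + t • y) F = 0 := by
  classical
  -- a frame `u` of `U = W₁ ∩ W₂` and vectors `v₁ ∈ W₁ ∖ U`, `v₂ ∈ W₂ ∖ U`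
  obtain ⟨u, hu, hU⟩ := exists_frame_of_finrank_eq h₁₂
  have hlt₁ : W₁ ⊓ W₂ < W₁ := by
    refine lt_of_le_of_ne inf_le_left fun h => ?_
    have : Module.finrank k ↥(W₁ ⊓ W₂) = Module.finrank k ↥W₁ := by rw [h]
    omega
  have hlt₂ : W₁ ⊓ W₂ < W₂ := by
    refine lt_of_le_of_ne inf_le_right fun h => ?_
    have : Module.finrank k ↥(W₁ ⊓ W₂) = Module.finrank k ↥W₂ := by rw [h]
    omega
  obtain ⟨v₁, hv₁W, hv₁U⟩ := SetLike.exists_of_lt hlt₁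
  obtain ⟨v₂, hv₂W, hv₂U⟩ := SetLike.exists_of_lt hlt₂
  -- the frames `(v₁, u)` of `W₁` and `e = (v₂, v₁, u)` of `W₁ + W₂`
  have hind₁ : LinearIndependent k (Fin.cons v₁ u : Fin (d + 1) → Fin (N + 1) → k) :=
    hu.finCons (by rwa [hU])
  have hspan₁ : Submodule.span k (Set.range (Fin.cons v₁ u : Fin (d + 1) → Fin (N + 1) → k)) =
      W₁ := by
    apply Submodule.eq_of_le_of_finrank_eq
    · rw [Fin.range_cons, Submodule.span_insert, hU]
      exact sup_le ((Submodule.span_singleton_le_iff_mem _ _).2 hv₁W) inf_le_left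
    · rw [finrank_span_eq_card hind₁, Fintype.card_fin, h₁]
  have hv₂W₁ : v₂ ∉ W₁ := fun h => hv₂U ⟨h, hv₂W⟩
  set e : Fin (d + 2) → Fin (N + 1) → k := Fin.cons v₂ (Fin.cons v₁ u) with he_def
  have he : LinearIndependent k e := hind₁.finCons (by rwa [hspan₁])
  have he0 : e 0 = v₂ := rfl
  have he1 : e 1 = v₁ := rfl
  have hess : ∀ j : Fin d, e j.succ.succ = u j := fun j => rfl
  have huW : ∀ j : Fin d, u j ∈ W₁ ⊓ W₂ := fun j => by
    rw [← hU]; exact Submodule.subset_span ⟨j, rfl⟩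
  -- the two sub-frames span `W₁` (index `0` killed) and `W₂` (index `1` killed)
  have hmem₁ : ∀ c : Fin (d + 2) → k, c 0 = 0 → (∑ j, c j • e j) ∈ W₁ := by
    intro c hc
    refine Submodule.sum_mem _ fun j _ => ?_
    refine Fin.cases ?_ (fun j' => Fin.cases ?_ (fun j'' => ?_) j') j
    · rw [hc, zero_smul]; exact Submodule.zero_mem _
    · exact Submodule.smul_mem _ _ (by rw [show e (Fin.succ 0) = v₁ from rfl]; exact hv₁W)
    · exact Submodule.smul_mem _ _ (by rw [hess]; exact (huW j'').1)
  have hmem₂ : ∀ c : Fin (d + 2) → k, c 1 = 0 → (∑ j, c j • e j) ∈ W₂ := by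
    intro c hc
    refine Submodule.sum_mem _ fun j _ => ?_
    refine Fin.cases ?_ (fun j' => Fin.cases ?_ (fun j'' => ?_) j') j
    · exact Submodule.smul_mem _ _ (by rw [he0]; exact hv₂W)
    · rw [show c (Fin.succ 0) = 0 from hc, zero_smul]; exact Submodule.zero_mem _
    · exact Submodule.smul_mem _ _ (by rw [hess]; exact (huW j'').2)
  have hvan₁ : ∀ c : Fin (d + 2) → k, c 0 = 0 → eval (fun x => ∑ j, c j * e j x) F = 0 := by
    intro c hc
    rw [sum_mul_apply_eq_sum_smul]
    exact hiso₁ _ (hmem₁ c hc)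
  have hvan₂ : ∀ c : Fin (d + 2) → k, c 1 = 0 → eval (fun x => ∑ j, c j * e j x) F = 0 := by
    intro c hc
    rw [sum_mul_apply_eq_sum_smul]
    exact hiso₂ _ (hmem₂ c hc)
  obtain ⟨y, hy, hy₁, hy₂⟩ := exists_common_zero_two_subframes_escaping_of_isCrSystem hK hF he 1 0
    Finset.univ hvan₁ hvan₂ (by rw [Finset.card_univ, Fintype.card_fin]; exact hN)
  rw [Finset.coe_univ, Set.image_univ] at hy
  -- the frame `(v₂, u)` of `W₂`
  have hind₂ : LinearIndependent k (Fin.cons v₂ u : Fin (d + 1) → Fin (N + 1) → k) :=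
    hu.finCons (by rwa [hU])
  have hspan₂ : Submodule.span k (Set.range (Fin.cons v₂ u : Fin (d + 1) → Fin (N + 1) → k)) =
      W₂ := by
    apply Submodule.eq_of_le_of_finrank_eq
    · rw [Fin.range_cons, Submodule.span_insert, hU]
      exact sup_le ((Submodule.span_singleton_le_iff_mem _ _).2 hv₂W) inf_le_right
    · rw [finrank_span_eq_card hind₂, Fintype.card_fin, h₂]
  -- translating back to `W₁`, `W₂`
  have hrange : Set.range e = insert v₂ (insert v₁ (Set.range u)) := by
    rw [he_def, Fin.range_cons, Fin.range_cons]
  have hsup : W₁ ⊔ W₂ ≤ Submodule.span k (Set.range e) := by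
    rw [hrange]
    refine sup_le ?_ ?_
    · rw [← hspan₁, Fin.range_cons]
      exact Submodule.span_mono (Set.subset_insert _ _)
    · rw [← hspan₂, Fin.range_cons]
      exact Submodule.span_mono (Set.insert_subset_insert (Set.subset_insert _ _))
  have hfun : ∀ (c : Fin (d + 2) → k) (t : k),
      (fun x => (∑ j, c j * e j x) + t * y x) = (∑ j, c j • e j) + t • y := by
    intro c t
    funext x
    simp [Finset.sum_apply, Pi.smul_apply]
  refine ⟨y, fun h => hy (hsup h), fun w hw t => ?_, fun w hw t => ?_⟩
  · rw [← hspan₁, Submodule.mem_span_range_iff_exists_fun] at hw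
    obtain ⟨c', rfl⟩ := hw
    have h := hy₁ (Fin.cons 0 c') t rfl
    have hvec : (∑ j, (Fin.cons 0 c' : Fin (d + 2) → k) j • e j) =
        ∑ j, c' j • (Fin.cons v₁ u : Fin (d + 1) → Fin (N + 1) → k) j := by
      simp only [he_def, Fin.sum_univ_succ, Fin.cons_zero, Fin.cons_succ, zero_smul, zero_add]
    rw [hfun, hvec] at h
    exact h
  · rw [← hspan₂, Submodule.mem_span_range_iff_exists_fun] at hw
    obtain ⟨c', rfl⟩ := hw
    have h := hy₂ (Fin.cons (c' 0) (Fin.cons 0 (Fin.tail c'))) t rfl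
    have hvec : (∑ j, (Fin.cons (c' 0) (Fin.cons 0 (Fin.tail c')) : Fin (d + 2) → k) j • e j) =
        ∑ j, c' j • (Fin.cons v₂ u : Fin (d + 1) → Fin (N + 1) → k) j := by
      simp only [he_def, Fin.sum_univ_succ, Fin.cons_zero, Fin.cons_succ, Fin.tail, zero_smul,
        zero_add]
    rw [hfun, hvec] at h
    exact h

/-- **Common isotropic extension over a `C_r` field, escaping only the intersection.** As
`exists_common_isotropic_extension_inf` (algebraically closed field), over a field with Pfister's
systems property `C_r` and with the degree count `Σ (3 - |f|)^r` in place of the number of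
conditions; otherwise verbatim: `y` is only required to avoid `W₁ ∩ W₂`, with the count
`#{f : Fin (d+2) → Fin 3, Σ f ≤ 2, f 1 = 0 ∨ f 0 = 0} + d < N + 1` (`d = 2`: `14 + 2 < N + 1`); then
`(W₁ ∩ W₂) + ky` has dimension `d + 1` and lies in the isotropic `W₁ + ky` and `W₂ + ky` (of
dimension `d + 1` or `d + 2`).

**Common isotropic extension of two isotropic subspaces meeting in codimension one.** Let `F`
be a cubic form on `kᴺ⁺¹`, `k` algebraically closed, and `W₁, W₂` isotropic subspaces of dimension
`d + 1` with `dim (W₁ ∩ W₂) = d`. If `#{f : Fin (d+2) → Fin 3, Σ f ≤ 2, f 1 = 0 ∨ f 0 = 0} + (d + 2)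
< N + 1` (`d = 1`: `9 + 3 < N + 1`; `d = 2`: `14 + 4 < N + 1`), there is a vector `y ∉ W₁ + W₂`
such that `W₁ + ky` and `W₂ + ky` are isotropic (`exists_common_zero_two_subframes` for the frame
`(v₂, v₁, u)`, `u` a frame of `W₁ ∩ W₂`, `W_a = span(v_a, u)`). [folklore] -/
theorem exists_common_isotropic_extension_inf_of_isCrSystem {r : ℕ} (hK : IsCrSystem r k)
    (hF : F.IsHomogeneous 3) {d : ℕ}
    {W₁ W₂ : Submodule k (Fin (N + 1) → k)} (h₁ : Module.finrank k W₁ = d + 1)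
    (h₂ : Module.finrank k W₂ = d + 1) (h₁₂ : Module.finrank k ↥(W₁ ⊓ W₂) = d)
    (hiso₁ : ∀ v ∈ W₁, eval v F = 0) (hiso₂ : ∀ v ∈ W₂, eval v F = 0)
    (hN : (Finset.univ.filter (fun f : Fin (d + 2) → Fin 3 =>
      ∑ j, (f j : ℕ) ≤ 2 ∧ (f 1 = 0 ∨ f 0 = 0))).sum (fun f => (3 - ∑ j, (f j : ℕ)) ^ r) + d <
        N + 1) :
    ∃ y : Fin (N + 1) → k, y ∉ W₁ ⊓ W₂ ∧ (∀ w ∈ W₁, ∀ t : k, eval (w + t • y) F = 0) ∧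
      ∀ w ∈ W₂, ∀ t : k, eval (w + t • y) F = 0 := by
  classical
  -- a frame `u` of `U = W₁ ∩ W₂` and vectors `v₁ ∈ W₁ ∖ U`, `v₂ ∈ W₂ ∖ U`
  obtain ⟨u, hu, hU⟩ := exists_frame_of_finrank_eq h₁₂
  have hlt₁ : W₁ ⊓ W₂ < W₁ := by
    refine lt_of_le_of_ne inf_le_left fun h => ?_
    have : Module.finrank k ↥(W₁ ⊓ W₂) = Module.finrank k ↥W₁ := by rw [h]
    omega
  have hlt₂ : W₁ ⊓ W₂ < W₂ := by
    refine lt_of_le_of_ne inf_le_right fun h => ?_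
    have : Module.finrank k ↥(W₁ ⊓ W₂) = Module.finrank k ↥W₂ := by rw [h]
    omega
  obtain ⟨v₁, hv₁W, hv₁U⟩ := SetLike.exists_of_lt hlt₁
  obtain ⟨v₂, hv₂W, hv₂U⟩ := SetLike.exists_of_lt hlt₂
  -- the frames `(v₁, u)` of `W₁` and `e = (v₂, v₁, u)` of `W₁ + W₂`
  have hind₁ : LinearIndependent k (Fin.cons v₁ u : Fin (d + 1) → Fin (N + 1) → k) :=
    hu.finCons (by rwa [hU])
  have hspan₁ : Submodule.span k (Set.range (Fin.cons v₁ u : Fin (d + 1) → Fin (N + 1) → k)) =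
      W₁ := by
    apply Submodule.eq_of_le_of_finrank_eq
    · rw [Fin.range_cons, Submodule.span_insert, hU]
      exact sup_le ((Submodule.span_singleton_le_iff_mem _ _).2 hv₁W) inf_le_left
    · rw [finrank_span_eq_card hind₁, Fintype.card_fin, h₁]
  have hv₂W₁ : v₂ ∉ W₁ := fun h => hv₂U ⟨h, hv₂W⟩
  set e : Fin (d + 2) → Fin (N + 1) → k := Fin.cons v₂ (Fin.cons v₁ u) with he_def
  have he : LinearIndependent k e := hind₁.finCons (by rwa [hspan₁])
  have he0 : e 0 = v₂ := rfl
  have he1 : e 1 = v₁ := rfl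
  have hess : ∀ j : Fin d, e j.succ.succ = u j := fun j => rfl
  have huW : ∀ j : Fin d, u j ∈ W₁ ⊓ W₂ := fun j => by
    rw [← hU]; exact Submodule.subset_span ⟨j, rfl⟩
  -- the two sub-frames span `W₁` (index `0` killed) and `W₂` (index `1` killed)
  have hmem₁ : ∀ c : Fin (d + 2) → k, c 0 = 0 → (∑ j, c j • e j) ∈ W₁ := by
    intro c hc
    refine Submodule.sum_mem _ fun j _ => ?_
    refine Fin.cases ?_ (fun j' => Fin.cases ?_ (fun j'' => ?_) j') j
    · rw [hc, zero_smul]; exact Submodule.zero_mem _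
    · exact Submodule.smul_mem _ _ (by rw [show e (Fin.succ 0) = v₁ from rfl]; exact hv₁W)
    · exact Submodule.smul_mem _ _ (by rw [hess]; exact (huW j'').1)
  have hmem₂ : ∀ c : Fin (d + 2) → k, c 1 = 0 → (∑ j, c j • e j) ∈ W₂ := by
    intro c hc
    refine Submodule.sum_mem _ fun j _ => ?_
    refine Fin.cases ?_ (fun j' => Fin.cases ?_ (fun j'' => ?_) j') j
    · exact Submodule.smul_mem _ _ (by rw [he0]; exact hv₂W)
    · rw [show c (Fin.succ 0) = 0 from hc, zero_smul]; exact Submodule.zero_mem _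
    · exact Submodule.smul_mem _ _ (by rw [hess]; exact (huW j'').2)
  have hvan₁ : ∀ c : Fin (d + 2) → k, c 0 = 0 → eval (fun x => ∑ j, c j * e j x) F = 0 := by
    intro c hc
    rw [sum_mul_apply_eq_sum_smul]
    exact hiso₁ _ (hmem₁ c hc)
  have hvan₂ : ∀ c : Fin (d + 2) → k, c 1 = 0 → eval (fun x => ∑ j, c j * e j x) F = 0 := by
    intro c hc
    rw [sum_mul_apply_eq_sum_smul]
    exact hiso₂ _ (hmem₂ c hc)
  -- the indices `≥ 2` of the frame, spanning `U`
  set S : Finset (Fin (d + 2)) := Finset.univ.image (fun j : Fin d => j.succ.succ) with hS_def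
  have hScard : S.card = d := by
    rw [hS_def, Finset.card_image_of_injective _ (fun a b h =>
      Fin.succ_injective _ (Fin.succ_injective _ h)), Finset.card_univ, Fintype.card_fin]
  have hSspan : Submodule.span k (e '' ↑S) = W₁ ⊓ W₂ := by
    rw [← hU]
    congr 1
    ext v
    simp only [hS_def, Finset.coe_image, Finset.coe_univ, Set.image_univ, Set.mem_image,
      Set.mem_range]
    constructor
    · rintro ⟨_, ⟨j, rfl⟩, rfl⟩
      exact ⟨j, (hess j).symm⟩
    · rintro ⟨j, rfl⟩
      exact ⟨_, ⟨j, rfl⟩, hess j⟩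
  obtain ⟨y, hy, hy₁, hy₂⟩ := exists_common_zero_two_subframes_escaping_of_isCrSystem hK hF he 1 0
    S hvan₁ hvan₂ (by rw [hScard]; exact hN)
  rw [hSspan] at hy
  -- the frame `(v₂, u)` of `W₂`
  have hind₂ : LinearIndependent k (Fin.cons v₂ u : Fin (d + 1) → Fin (N + 1) → k) :=
    hu.finCons (by rwa [hU])
  have hspan₂ : Submodule.span k (Set.range (Fin.cons v₂ u : Fin (d + 1) → Fin (N + 1) → k)) =
      W₂ := by
    apply Submodule.eq_of_le_of_finrank_eq
    · rw [Fin.range_cons, Submodule.span_insert, hU]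
      exact sup_le ((Submodule.span_singleton_le_iff_mem _ _).2 hv₂W) inf_le_right
    · rw [finrank_span_eq_card hind₂, Fintype.card_fin, h₂]
  -- translating back to `W₁`, `W₂`
  have hfun : ∀ (c : Fin (d + 2) → k) (t : k),
      (fun x => (∑ j, c j * e j x) + t * y x) = (∑ j, c j • e j) + t • y := by
    intro c t
    funext x
    simp [Finset.sum_apply, Pi.smul_apply]
  refine ⟨y, hy, fun w hw t => ?_, fun w hw t => ?_⟩
  · rw [← hspan₁, Submodule.mem_span_range_iff_exists_fun] at hw
    obtain ⟨c', rfl⟩ := hw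
    have h := hy₁ (Fin.cons 0 c') t rfl
    have hvec : (∑ j, (Fin.cons 0 c' : Fin (d + 2) → k) j • e j) =
        ∑ j, c' j • (Fin.cons v₁ u : Fin (d + 1) → Fin (N + 1) → k) j := by
      simp only [he_def, Fin.sum_univ_succ, Fin.cons_zero, Fin.cons_succ, zero_smul, zero_add]
    rw [hfun, hvec] at h
    exact h
  · rw [← hspan₂, Submodule.mem_span_range_iff_exists_fun] at hw
    obtain ⟨c', rfl⟩ := hw
    have h := hy₂ (Fin.cons (c' 0) (Fin.cons 0 (Fin.tail c'))) t rfl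
    have hvec : (∑ j, (Fin.cons (c' 0) (Fin.cons 0 (Fin.tail c')) : Fin (d + 2) → k) j • e j) =
        ∑ j, c' j • (Fin.cons v₂ u : Fin (d + 1) → Fin (N + 1) → k) j := by
      simp only [he_def, Fin.sum_univ_succ, Fin.cons_zero, Fin.cons_succ, Fin.tail, zero_smul,
        zero_add]
    rw [hfun, hvec] at h
    exact h

end Isotropic

/-! ### Chains of lines through common planes over a `C₁` field -/

section LineChains

variable {F : MvPolynomial (Fin (N + 1)) k}

/-- **Two isotropic lines through a common point are joined by two coplanar steps** (`C₁` field,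
`N ≥ 15`: count `14 + 1 < N + 1`): there is an isotropic line `m` through the common point lying in a
common isotropic `3`-space with each of them. [folklore] -/
theorem exists_line_between_of_finrank_inf_eq_one (hK : IsCrSystem 1 k) (hN : 15 ≤ N)
    (hF : F.IsHomogeneous 3) {ℓ₁ ℓ₂ : Submodule k (Fin (N + 1) → k)}
    (h₁ : Module.finrank k ℓ₁ = 2) (h₂ : Module.finrank k ℓ₂ = 2)
    (h₁₂ : Module.finrank k ↥(ℓ₁ ⊓ ℓ₂) = 1) (hiso₁ : ∀ v ∈ ℓ₁, eval v F = 0)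
    (hiso₂ : ∀ v ∈ ℓ₂, eval v F = 0) :
    ∃ m π₁ π₂ : Submodule k (Fin (N + 1) → k), Module.finrank k m = 2 ∧ (∀ v ∈ m, eval v F = 0) ∧
      ℓ₁ ≤ π₁ ∧ m ≤ π₁ ∧ Module.finrank k π₁ = 3 ∧ (∀ v ∈ π₁, eval v F = 0) ∧
      m ≤ π₂ ∧ ℓ₂ ≤ π₂ ∧ Module.finrank k π₂ = 3 ∧ (∀ v ∈ π₂, eval v F = 0) := by
  obtain ⟨w, hwU, hw₁, hw₂⟩ := exists_common_isotropic_extension_inf_of_isCrSystem hK hF (d := 1)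
    h₁ h₂ h₁₂ hiso₁ hiso₂ (by
      change (Finset.univ.filter (fun f : Fin 3 → Fin 3 =>
        ∑ j, (f j : ℕ) ≤ 2 ∧ (f 1 = 0 ∨ f 0 = 0))).sum (fun f => (3 - ∑ j, (f j : ℕ)) ^ 1) + 1 < N + 1
      rw [sum_filter_fin_three_or_pow_one]
      omega)
  -- the line `m = (ℓ₁ ∩ ℓ₂) + kw` and the isotropic spaces `ℓ_a + kw`
  have hm : Module.finrank k ↥((ℓ₁ ⊓ ℓ₂) ⊔ Submodule.span k {w}) = 2 := by
    rw [Submodule.finrank_sup_span_singleton hwU, h₁₂]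
  have hM₁iso : ∀ v ∈ ℓ₁ ⊔ Submodule.span k {w}, eval v F = 0 := forall_mem_sup_span_singleton' hw₁
  have hM₂iso : ∀ v ∈ ℓ₂ ⊔ Submodule.span k {w}, eval v F = 0 := forall_mem_sup_span_singleton' hw₂
  have hmM₁ : (ℓ₁ ⊓ ℓ₂) ⊔ Submodule.span k {w} ≤ ℓ₁ ⊔ Submodule.span k {w} :=
    sup_le_sup_right inf_le_left _
  have hmM₂ : (ℓ₁ ⊓ ℓ₂) ⊔ Submodule.span k {w} ≤ ℓ₂ ⊔ Submodule.span k {w} :=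
    sup_le_sup_right inf_le_right _
  -- each `ℓ_a + kw` has dimension `2` or `3`; enlarge it to an isotropic `3`-space
  have hM₁le : Module.finrank k ↥(ℓ₁ ⊔ Submodule.span k {w}) ≤ 3 := by
    have h := Submodule.finrank_add_le_finrank_add_finrank ℓ₁ (Submodule.span k {w})
    have h1 : Module.finrank k ↥(Submodule.span k {w}) ≤ 1 := finrank_span_singleton_le' w
    omega
  have hM₂le : Module.finrank k ↥(ℓ₂ ⊔ Submodule.span k {w}) ≤ 3 := by
    have h := Submodule.finrank_add_le_finrank_add_finrank ℓ₂ (Submodule.span k {w})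
    have h1 : Module.finrank k ↥(Submodule.span k {w}) ≤ 1 := finrank_span_singleton_le' w
    omega
  obtain ⟨π₁, hMπ₁, hπ₁, hπ₁iso⟩ := exists_isotropic_finrank_three_ge_of_le_three hK (by omega) hF
    hM₁le hM₁iso
  obtain ⟨π₂, hMπ₂, hπ₂, hπ₂iso⟩ := exists_isotropic_finrank_three_ge_of_le_three hK (by omega) hF
    hM₂le hM₂iso
  exact ⟨(ℓ₁ ⊓ ℓ₂) ⊔ Submodule.span k {w}, π₁, π₂, hm, fun v hv => hM₁iso v (hmM₁ hv),
    le_sup_left.trans hMπ₁, hmM₁.trans hMπ₁, hπ₁, hπ₁iso, hmM₂.trans hMπ₂,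
    le_sup_left.trans hMπ₂, hπ₂, hπ₂iso⟩

/-- **Two isotropic lines meeting in a point are chain-connected through isotropic `3`-spaces**
(`C₁` field, `N ≥ 15`), as a `Relation.ReflTransGen` statement for the relation "both are
`2`-dimensional and lie in a common isotropic `3`-space". [folklore] -/
theorem reflTransGen_coplanar_of_one_le_finrank_inf (hK : IsCrSystem 1 k) (hN : 15 ≤ N)
    (hF : F.IsHomogeneous 3) {ℓ₁ ℓ₂ : Submodule k (Fin (N + 1) → k)}
    (h₁ : Module.finrank k ℓ₁ = 2) (h₂ : Module.finrank k ℓ₂ = 2)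
    (hiso₁ : ∀ v ∈ ℓ₁, eval v F = 0) (hiso₂ : ∀ v ∈ ℓ₂, eval v F = 0)
    (h₁₂ : 1 ≤ Module.finrank k ↥(ℓ₁ ⊓ ℓ₂)) :
    Relation.ReflTransGen (fun ℓ ℓ' : Submodule k (Fin (N + 1) → k) =>
      Module.finrank k ℓ = 2 ∧ Module.finrank k ℓ' = 2 ∧
        ∃ π : Submodule k (Fin (N + 1) → k), ℓ ≤ π ∧ ℓ' ≤ π ∧ Module.finrank k π = 3 ∧
          ∀ v ∈ π, eval v F = 0) ℓ₁ ℓ₂ := by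
  by_cases htwo : 2 ≤ Module.finrank k ↥(ℓ₁ ⊓ ℓ₂)
  · -- the lines coincide
    have hle : Module.finrank k ↥(ℓ₁ ⊓ ℓ₂) ≤ 2 := h₁ ▸ Submodule.finrank_mono inf_le_left
    have heq₁ : ℓ₁ ⊓ ℓ₂ = ℓ₁ := Submodule.eq_of_le_of_finrank_eq inf_le_left (by omega)
    have heq₂ : ℓ₁ ⊓ ℓ₂ = ℓ₂ := Submodule.eq_of_le_of_finrank_eq inf_le_right (by omega)
    rw [← heq₁, heq₂]
  · have hone : Module.finrank k ↥(ℓ₁ ⊓ ℓ₂) = 1 := by omega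
    obtain ⟨m, π₁, π₂, hm, hmiso, hℓπ₁, hmπ₁, hπ₁, hπ₁iso, hmπ₂, hℓπ₂, hπ₂, hπ₂iso⟩ :=
      exists_line_between_of_finrank_inf_eq_one hK hN hF h₁ h₂ hone hiso₁ hiso₂
    exact (Relation.ReflTransGen.single ⟨h₁, hm, π₁, hℓπ₁, hmπ₁, hπ₁, hπ₁iso⟩).trans
      (Relation.ReflTransGen.single ⟨hm, h₂, π₂, hmπ₂, hℓπ₂, hπ₂, hπ₂iso⟩)

/-- **Any two isotropic lines are chain-connected through isotropic `3`-spaces** over a `C₁` field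
(cubic form in `N + 1 ≥ 16` variables): geometrically, any two `K`-lines of a cubic hypersurface
`X` of dimension `n ≥ 14` over the function field `K` of a curve are joined by a chain of `K`-lines
of `X_K` in which consecutive lines span a `K`-plane of `X_K` (two arbitrary lines are linked to
lines through a common vertex, `9 + 2 < N + 1`; lines through a common point by
`exists_line_between_of_finrank_inf_eq_one`, `14 + 1 < N + 1`). [folklore] -/
theorem reflTransGen_coplanar_of_isCrSystem_one (hK : IsCrSystem 1 k) (hN : 15 ≤ N)
    (hF : F.IsHomogeneous 3) {ℓ₁ ℓ₂ : Submodule k (Fin (N + 1) → k)}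
    (h₁ : Module.finrank k ℓ₁ = 2) (h₂ : Module.finrank k ℓ₂ = 2)
    (hiso₁ : ∀ v ∈ ℓ₁, eval v F = 0) (hiso₂ : ∀ v ∈ ℓ₂, eval v F = 0) :
    Relation.ReflTransGen (fun ℓ ℓ' : Submodule k (Fin (N + 1) → k) =>
      Module.finrank k ℓ = 2 ∧ Module.finrank k ℓ' = 2 ∧
        ∃ π : Submodule k (Fin (N + 1) → k), ℓ ≤ π ∧ ℓ' ≤ π ∧ Module.finrank k π = 3 ∧
          ∀ v ∈ π, eval v F = 0) ℓ₁ ℓ₂ := by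
  by_cases hone : 1 ≤ Module.finrank k ↥(ℓ₁ ⊓ ℓ₂)
  · exact reflTransGen_coplanar_of_one_le_finrank_inf hK hN hF h₁ h₂ hiso₁ hiso₂ hone
  -- disjoint lines: a common vertex `y` for points `p₁ ∈ ℓ₁`, `p₂ ∈ ℓ₂`
  have h0 : ℓ₁ ⊓ ℓ₂ = ⊥ := Submodule.finrank_eq_zero.1 (by omega)
  have hne₁ : ℓ₁ ≠ ⊥ := fun h => by rw [h, finrank_bot] at h₁; omega
  have hne₂ : ℓ₂ ≠ ⊥ := fun h => by rw [h, finrank_bot] at h₂; omega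
  obtain ⟨p₁, hp₁, hp₁0⟩ := Submodule.exists_mem_ne_zero_of_ne_bot hne₁
  obtain ⟨p₂, hp₂, hp₂0⟩ := Submodule.exists_mem_ne_zero_of_ne_bot hne₂
  have hP₁ : Module.finrank k ↥(Submodule.span k {p₁}) = 0 + 1 := by
    rw [finrank_span_singleton hp₁0]
  have hP₂ : Module.finrank k ↥(Submodule.span k {p₂}) = 0 + 1 := by
    rw [finrank_span_singleton hp₂0]
  have hP₁ℓ : Submodule.span k {p₁} ≤ ℓ₁ := (Submodule.span_singleton_le_iff_mem _ _).2 hp₁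
  have hP₂ℓ : Submodule.span k {p₂} ≤ ℓ₂ := (Submodule.span_singleton_le_iff_mem _ _).2 hp₂
  have hPP : Module.finrank k ↥(Submodule.span k {p₁} ⊓ Submodule.span k {p₂}) = 0 := by
    have : Submodule.span k {p₁} ⊓ Submodule.span k {p₂} = ⊥ :=
      eq_bot_iff.2 (h0 ▸ inf_le_inf hP₁ℓ hP₂ℓ)
    rw [this, finrank_bot]
  obtain ⟨y, hy, hy₁, hy₂⟩ := exists_common_isotropic_extension_of_isCrSystem hK hF (d := 0) hP₁ hP₂
    hPP (fun v hv => hiso₁ v (hP₁ℓ hv)) (fun v hv => hiso₂ v (hP₂ℓ hv)) (by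
      change (Finset.univ.filter (fun f : Fin 2 → Fin 3 =>
        ∑ j, (f j : ℕ) ≤ 2 ∧ (f 1 = 0 ∨ f 0 = 0))).sum (fun f => (3 - ∑ j, (f j : ℕ)) ^ 1) + 2 < N + 1
      rw [sum_filter_fin_two_or_pow_one]
      omega)
  have hy0 : y ≠ 0 := fun h => hy (h ▸ Submodule.zero_mem _)
  have hyP₁ : y ∉ Submodule.span k {p₁} := fun h => hy (Submodule.mem_sup_left h)
  have hyP₂ : y ∉ Submodule.span k {p₂} := fun h => hy (Submodule.mem_sup_right h)
  -- the lines `L_a = kp_a + ky`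
  have hL₁ : Module.finrank k ↥(Submodule.span k {p₁} ⊔ Submodule.span k {y}) = 2 := by
    rw [Submodule.finrank_sup_span_singleton hyP₁, hP₁]
  have hL₂ : Module.finrank k ↥(Submodule.span k {p₂} ⊔ Submodule.span k {y}) = 2 := by
    rw [Submodule.finrank_sup_span_singleton hyP₂, hP₂]
  have hL₁iso : ∀ v ∈ Submodule.span k {p₁} ⊔ Submodule.span k {y}, eval v F = 0 :=
    forall_mem_sup_span_singleton' hy₁
  have hL₂iso : ∀ v ∈ Submodule.span k {p₂} ⊔ Submodule.span k {y}, eval v F = 0 :=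
    forall_mem_sup_span_singleton' hy₂
  -- the three links `ℓ₁ ~ L₁ ~ L₂ ~ ℓ₂`, each between lines meeting in a point
  have e₁ := reflTransGen_coplanar_of_one_le_finrank_inf hK hN hF h₁ hL₁ hiso₁ hL₁iso (by
    have hmono := Submodule.finrank_mono (R := k)
      (le_inf hP₁ℓ le_sup_left :
        Submodule.span k {p₁} ≤ ℓ₁ ⊓ (Submodule.span k {p₁} ⊔ Submodule.span k {y}))
    have h1 := finrank_span_singleton (K := k) hp₁0
    omega)
  have e₂ := reflTransGen_coplanar_of_one_le_finrank_inf hK hN hF hL₁ hL₂ hL₁iso hL₂iso (by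
    have hmono := Submodule.finrank_mono (R := k)
      (le_inf le_sup_right le_sup_right :
        Submodule.span k {y} ≤ (Submodule.span k {p₁} ⊔ Submodule.span k {y}) ⊓
          (Submodule.span k {p₂} ⊔ Submodule.span k {y}))
    have h1 := finrank_span_singleton (K := k) hy0
    omega)
  have e₃ := reflTransGen_coplanar_of_one_le_finrank_inf hK hN hF hL₂ h₂ hL₂iso hiso₂ (by
    have hmono := Submodule.finrank_mono (R := k)
      (le_inf le_sup_left hP₂ℓ :
        Submodule.span k {p₂} ≤ (Submodule.span k {p₂} ⊔ Submodule.span k {y}) ⊓ ℓ₂)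
    have h1 := finrank_span_singleton (K := k) hp₂0
    omega)
  exact e₁.trans (e₂.trans e₃)

end LineChains

end Literature.RingTheory.MvPolynomial

end
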